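import Summits.HubbardSuperconductivity.HubbardSuperconductivity.Theorems.InfiniteVolumeFirstCoarseTightnessDeviationMain
import Summits.HubbardSuperconductivity.HubbardSuperconductivity.Theorems.InfiniteVolumeFirstCoarseTightnessBlockPairGramBound
import Summits.HubbardSuperconductivity.HubbardSuperconductivity.Theorems.InfiniteVolumeFirstCoarseTightnessAggregate
import Summits.HubbardSuperconductivity.HubbardSuperconductivity.Theorems.InfiniteVolumeFirstCoarseTightnessCorollaries
import HarnessLib

/-!
# Coarse tightness programme — THE MESOSCOPIC PAIR-ORDER CEILING

Crux `NoInfraredPileUp` (stmt-HubbardSuperconductivity-18534) / `NoNormalLimitState` (stmt-18533),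
route `InfiniteVolumeFirst`; calibration programme (PLAN-coarse-tightness.md, step S9 — the
assembly). For every normalised `(2n, S^z = 0)`-sector ground state `φ` of `hubbardTorus 2 L 1 U`,
`U ∈ [0,1]`, every block side `R ≥ 1` with `2R + 2 ≤ L` and every shell width `τ ∈ (0,1]`, the
translation-AVERAGED block `d`-wave pair order at scale `R`,
`𝓜 = (Σ_a ‖B_a φ‖²)/(L² R⁴)`, `B_a = Σ_{u ∈ [0,R)²} P_{a+u}`, satisfies

  `𝓜 ≤ 16512/R + 65536 √τ + (128/√τ) √(U + (72 + 32π)/R)`   (`mesoCeiling_holds`),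

the exact hypothesis the corollary file `…CoarseTightnessCorollaries` consumes to give COARSE
TIGHTNESS (η before U: no macroscopic generalised `d`-wave pair condensation at small momenta in any
weak-coupling ground state) and the UNCONDITIONAL ATOM CEILING (every torus-limit of every
weak-coupling ground-state family has `d`-wave condensate density `O(U^{1/4})`). Assembly of: the
per-block pair Gram bound in the Dirichlet sine basis (`blockPairGram_bound` with `φ_j = blockMode R j`,
`κ_j = λ^{(1,-1)}_j/√2`, `|κ_j| ≤ 2√2` — `BlockKernelBridge`), the shell/Hölder aggregation
(`sum_le_of_gram_shell_budget`), the uniform √-shell count of the Dirichlet block levels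
(`card_blockShell_le`) and the local kinetic budget (`deviationBudget`). The constants are crude; only
their finiteness and the shape matter.

No definition and no named fact is introduced.
-/

noncomputable section

set_option linter.dupNamespace false

namespace Summit.HubbardSuperconductivity.HubbardSuperconductivity.Theorems.CoarseTightness

open Literature.MathematicalPhysics.QuantumLattice Literature.Probability.LatticeModels Matrix Finset
open Literature.MathematicalPhysics.QuantumLattice.RayleighBound
open scoped ComplexConjugate ComplexOrder Topology
open Filter

section Meso

open Classical

variable {L : ℕ} [NeZero L]

omit [NeZero L] in
/-- A nonzero vector of the sector `(2n, 0)` forces `n ≤ L²`: a configuration in its support has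
exactly `n` spin-up orbitals among the `L²` sites. [folklore] -/
theorem le_sq_of_mem_szSector_of_unit {n : ℕ} {ψ : Fock (Orb (FermionTorus 2 L))}
    (hψ : ψ ∈ szSector (Λ := FermionTorus 2 L) (2 * n) 0) (h1 : star ψ ⬝ᵥ ψ = 1) : n ≤ L ^ 2 := by
  have hsec : IsInSector n n ψ := (mem_szSector_two_mul_zero_iff n ψ).1 hψ
  have hne : ψ ≠ 0 := by
    intro h0; rw [h0, dotProduct_zero] at h1; exact zero_ne_one h1
  obtain ⟨s, hs⟩ : ∃ s, ψ s ≠ 0 := Function.ne_iff.1 hne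
  have hcard : (upPart s).card = n := by
    by_contra h
    exact hs (hsec s fun hh => h hh.1)
  rw [← hcard, ← card_fermionTorus 2 L]
  exact Finset.card_le_univ _

/-- The `x(1-x)` summands of the deviation sum are nonnegative on `[0,1]`. [folklore] -/
theorem mul_one_sub_nonneg_of_mem_Icc {x : ℝ} (hx : x ∈ Set.Icc (0 : ℝ) 1) : 0 ≤ x * (1 - x) :=
  mul_nonneg hx.1 (by linarith [hx.2])

/-- **The mesoscopic pair-order ceiling** (the assembly of the coarse-tightness programme).
[folklore] -/
theorem mesoCeiling {τ : ℝ} (hτ : τ ∈ Set.Ioc (0 : ℝ) 1) {R : ℕ} (hR : 1 ≤ R) (hRL : 2 * R + 2 ≤ L)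
    {U : ℝ} (hU : U ∈ Set.Icc (0 : ℝ) 1) {n : ℕ} {φ : Fock (Orb (FermionTorus 2 L))}
    (h1 : star φ ⬝ᵥ φ = 1) (hGS : IsGroundStateInSector (hubbardTorus 2 L 1 U) (2 * n) 0 φ) :
    (∑ a : TorusSite 2 L, (star ((∑ u : Fin 2 → Fin R,
        localPair dWaveFormFactor L (a + fun i => ((u i : ℕ) : ZMod L))) *ᵥ φ) ⬝ᵥ
        ((∑ u : Fin 2 → Fin R, localPair dWaveFormFactor L (a + fun i => ((u i : ℕ) : ZMod L))) *ᵥ φ)).re) /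
        ((L : ℝ) ^ 2 * (R : ℝ) ^ 4) ≤
      16512 / R + 65536 * Real.sqrt τ +
        128 / Real.sqrt τ * Real.sqrt (U + (72 + 32 * Real.pi) / R) := by
  have hRL' : R ≤ L := by omega
  have hn : n ≤ L ^ 2 := le_sq_of_mem_szSector_of_unit hGS.1 h1
  -- the budget
  obtain ⟨μ, hμ, hbud⟩ := deviationBudget hR hRL hU.1 hn hGS h1 (R := R)
  -- occupations of the spin-up block modes
  set x : TorusSite 2 L → (Fin 2 → Fin R) → ℝ := fun a j => (star φ ⬝ᵥ (numberMode (Function.extend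
      (fun u : Fin 2 → Fin R => orb (FermionTorus.ofTorusSite (a + fun i => ((u i : ℕ) : ZMod L))) 0)
      (fun u => ((blockMode R j u : ℝ) : ℂ)) 0) *ᵥ φ)).re with hx
  have hxI : ∀ a j, x a j ∈ Set.Icc (0 : ℝ) 1 := fun a j =>
    re_expect_numberMode_mem_Icc (star_mode_dotProduct_self (blockOrb_injective a hRL' 0) (blockMode R)
      (sum_blockMode_mul_blockMode R) j) h1
  set w : (Fin 2 → Fin R) → ℝ := fun j => |torusBand (2 * R + 2) (blockMomentum R j) - μ| with hw
  have hw0 : ∀ j, 0 ≤ w j := fun j => abs_nonneg _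
  -- drop the spin-down part of the budget
  have hBud : ∑ a : TorusSite 2 L, ∑ j : Fin 2 → Fin R, w j * (x a j * (1 - x a j)) ≤
      (L : ℝ) ^ 2 * (R : ℝ) ^ 2 * (U + (72 + 32 * Real.pi) / R) := by
    refine le_trans (Finset.sum_le_sum fun a _ => ?_) hbud
    rw [Fin.sum_univ_two]
    have hnn : 0 ≤ ∑ j : Fin 2 → Fin R, |torusBand (2 * R + 2) (blockMomentum R j) - μ| *
        ((star φ ⬝ᵥ (numberMode (Function.extend
          (fun u : Fin 2 → Fin R => orb (FermionTorus.ofTorusSite (a + fun i => ((u i : ℕ) : ZMod L))) 1)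
          (fun u => ((blockMode R j u : ℝ) : ℂ)) 0) *ᵥ φ)).re *
         (1 - (star φ ⬝ᵥ (numberMode (Function.extend
          (fun u : Fin 2 → Fin R => orb (FermionTorus.ofTorusSite (a + fun i => ((u i : ℕ) : ZMod L))) 1)
          (fun u => ((blockMode R j u : ℝ) : ℂ)) 0) *ᵥ φ)).re)) :=
      Finset.sum_nonneg fun j _ => mul_nonneg (abs_nonneg _) (mul_one_sub_nonneg_of_mem_Icc
        (re_expect_numberMode_mem_Icc (star_mode_dotProduct_self (blockOrb_injective a hRL' 1)
          (blockMode R) (sum_blockMode_mul_blockMode R) j) h1))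
    simp only [hx, hw]
    exact le_add_of_nonneg_right hnn
  -- per-block Gram bound in the sine basis
  have hGram := fun a : TorusSite 2 L => blockPairGram_bound a hRL' (blockMode R)
    (sum_blockMode_mul_blockMode R) (fun j => blockEigen R (fun i => dWaveFormFactor (Pi.single i 1)) j /
      Real.sqrt 2) (2 * Real.sqrt 2) (abs_dWaveBlockEigen_div_sqrt_two_le R)
    (dWaveStepKernel_eq_sum_blockMode R) φ h1
  have hQ : 8 * (2 * Real.sqrt 2) ^ 2 = 64 := by
    rw [mul_pow, Real.sq_sqrt (by norm_num : (0 : ℝ) ≤ 2)]; norm_num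
  simp only [hQ] at hGram
  -- the shell count
  have hN := card_blockShell_le R μ τ
  -- aggregate
  have agg := sum_le_of_gram_shell_budget x (fun a j => (hxI a j).1) (fun a j => (hxI a j).2) w hw0 hτ.1
    hN _ (by norm_num : (0 : ℝ) ≤ 64) hGram hBud
  rw [card_torusSite, Fintype.card_fun, Fintype.card_fin, Fintype.card_fin] at agg
  push_cast at agg
  -- real arithmetic
  have hRr : (1 : ℝ) ≤ R := by exact_mod_cast hR
  have hRpos : (0 : ℝ) < R := by linarith
  have hL4 : (4 : ℝ) ≤ L := by
    have : 2 * (R : ℝ) + 2 ≤ L := by exact_mod_cast hRL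
    linarith
  have hLpos : (0 : ℝ) < L := by linarith
  have hτpos := hτ.1
  have hsτ : 0 < Real.sqrt τ := Real.sqrt_pos.2 hτpos
  have hτle : τ ≤ Real.sqrt τ := by
    have h1' : Real.sqrt τ ≤ 1 := by
      have := Real.sqrt_le_sqrt hτ.2
      rwa [Real.sqrt_one] at this
    calc τ = Real.sqrt τ * Real.sqrt τ := (Real.mul_self_sqrt hτpos.le).symm
      _ ≤ Real.sqrt τ * 1 := mul_le_mul_of_nonneg_left h1' (Real.sqrt_nonneg τ)
      _ = Real.sqrt τ := mul_one _
  set C : ℝ := U + (72 + 32 * Real.pi) / R with hC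
  have hC0 : 0 ≤ C := add_nonneg hU.1 (div_nonneg (by positivity) hRpos.le)
  -- the square-root term
  have hsqrt : Real.sqrt (((R : ℝ) ^ 2) ^ 3 * ((L : ℝ) ^ 2 * ((L : ℝ) ^ 2 * (R : ℝ) ^ 2 * C)) / τ) =
      (R : ℝ) ^ 4 * (L : ℝ) ^ 2 * (Real.sqrt C / Real.sqrt τ) := by
    rw [show ((R : ℝ) ^ 2) ^ 3 * ((L : ℝ) ^ 2 * ((L : ℝ) ^ 2 * (R : ℝ) ^ 2 * C)) / τ =
        ((R : ℝ) ^ 4 * (L : ℝ) ^ 2) ^ 2 * (C / τ) by ring]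
    rw [Real.sqrt_mul (sq_nonneg _), Real.sqrt_sq (by positivity), Real.sqrt_div' C hτpos.le]
  rw [hsqrt] at agg
  -- the shell-count term: `N ≤ 16 √τ R² + 8 R`, `N² ≤ 512 τ R⁴ + 128 R²`
  have hNle : Real.sqrt τ * (2 * (R : ℝ) + 2) ^ 2 + 2 * (2 * (R : ℝ) + 2) ≤
      16 * Real.sqrt τ * (R : ℝ) ^ 2 + 8 * R := by
    nlinarith [mul_le_mul_of_nonneg_left (by nlinarith : (2 * (R : ℝ) + 2) ^ 2 ≤ 16 * (R : ℝ) ^ 2)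
      hsτ.le]
  have hN0 : 0 ≤ Real.sqrt τ * (2 * (R : ℝ) + 2) ^ 2 + 2 * (2 * (R : ℝ) + 2) := by positivity
  have hNsq : (Real.sqrt τ * (2 * (R : ℝ) + 2) ^ 2 + 2 * (2 * (R : ℝ) + 2)) ^ 2 ≤
      512 * τ * (R : ℝ) ^ 4 + 128 * (R : ℝ) ^ 2 := by
    calc (Real.sqrt τ * (2 * (R : ℝ) + 2) ^ 2 + 2 * (2 * (R : ℝ) + 2)) ^ 2
        ≤ (16 * Real.sqrt τ * (R : ℝ) ^ 2 + 8 * R) ^ 2 :=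
          pow_le_pow_left₀ hN0 hNle 2
      _ ≤ 2 * (16 * Real.sqrt τ * (R : ℝ) ^ 2) ^ 2 + 2 * (8 * (R : ℝ)) ^ 2 := by
          nlinarith [sq_nonneg (16 * Real.sqrt τ * (R : ℝ) ^ 2 - 8 * R)]
      _ = 512 * τ * (R : ℝ) ^ 4 + 128 * (R : ℝ) ^ 2 := by
          rw [mul_pow, mul_pow, Real.sq_sqrt hτpos.le]; ring
  -- divide
  rw [div_le_iff₀ (by positivity)]
  have hrhs : (16512 / (R : ℝ) + 65536 * Real.sqrt τ + 128 / Real.sqrt τ * Real.sqrt C) *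
      ((L : ℝ) ^ 2 * (R : ℝ) ^ 4) =
      16512 * (L : ℝ) ^ 2 * (R : ℝ) ^ 3 + 65536 * Real.sqrt τ * (L : ℝ) ^ 2 * (R : ℝ) ^ 4 +
        128 * ((R : ℝ) ^ 4 * (L : ℝ) ^ 2 * (Real.sqrt C / Real.sqrt τ)) := by
    field_simp
  rw [hrhs]
  refine agg.trans ?_
  -- compare term by term
  have hsC0 : 0 ≤ Real.sqrt C / Real.sqrt τ := div_nonneg (Real.sqrt_nonneg _) hsτ.le
  have h3 : 2 * 64 * ((R : ℝ) ^ 4 * (L : ℝ) ^ 2 * (Real.sqrt C / Real.sqrt τ)) =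
      128 * ((R : ℝ) ^ 4 * (L : ℝ) ^ 2 * (Real.sqrt C / Real.sqrt τ)) := by ring
  rw [h3, add_le_add_iff_right]
  have hL2 : 0 ≤ (L : ℝ) ^ 2 := sq_nonneg _
  -- `L² (64R² + 64R² + 128 N²) ≤ 16512 L² R³ + 65536 √τ L² R⁴`
  have hin : 64 * (R : ℝ) ^ 2 + 64 * (R : ℝ) ^ 2 +
      2 * 64 * (Real.sqrt τ * (2 * (R : ℝ) + 2) ^ 2 + 2 * (2 * (R : ℝ) + 2)) ^ 2 ≤
      16512 * (R : ℝ) ^ 3 + 65536 * Real.sqrt τ * (R : ℝ) ^ 4 := by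
    have hR2 : (R : ℝ) ^ 2 ≤ (R : ℝ) ^ 3 := pow_le_pow_right₀ hRr (by norm_num)
    have hτR : τ * (R : ℝ) ^ 4 ≤ Real.sqrt τ * (R : ℝ) ^ 4 := mul_le_mul_of_nonneg_right hτle (by positivity)
    linarith [hNsq, hR2, hτR]
  calc (L : ℝ) ^ 2 * (64 * (R : ℝ) ^ 2 + 64 * (R : ℝ) ^ 2 +
        2 * 64 * (Real.sqrt τ * (2 * (R : ℝ) + 2) ^ 2 + 2 * (2 * (R : ℝ) + 2)) ^ 2)
      ≤ (L : ℝ) ^ 2 * (16512 * (R : ℝ) ^ 3 + 65536 * Real.sqrt τ * (R : ℝ) ^ 4) :=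
        mul_le_mul_of_nonneg_left hin hL2
    _ = 16512 * (L : ℝ) ^ 2 * (R : ℝ) ^ 3 + 65536 * Real.sqrt τ * (L : ℝ) ^ 2 * (R : ℝ) ^ 4 := by ring

/-! ### The ceiling in closed form, and the two unconditional corollaries -/

/-- Registered stub `stub_coarseMesoCeiling` = **the mesoscopic pair-order ceiling (MC)** in the
closed form consumed by `coarseTightness_of_mesoCeiling` / `atom_le_of_mesoCeiling`. [folklore] -/
theorem stub_coarseMesoCeiling :
    ∀ τ ∈ Set.Ioc (0:ℝ) 1, ∀ R : ℕ, 1 ≤ R → ∀ (L : ℕ) [NeZero L], 2 * R + 2 ≤ L → ∀ U ∈ Set.Icc (0:ℝ) 1, ∀ (n : ℕ) (φ : Fock (Orb (FermionTorus 2 L))), star φ ⬝ᵥ φ = 1 → IsGroundStateInSector (hubbardTorus 2 L 1 U) (2 * n) 0 φ → (∑ a : TorusSite 2 L, (star ((∑ u : Fin 2 → Fin R, localPair dWaveFormFactor L (a + fun i => ((u i : ℕ) : ZMod L))) *ᵥ φ) ⬝ᵥ ((∑ u : Fin 2 → Fin R, localPair dWaveFormFactor L (a + fun i => ((u i : ℕ)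 : ZMod L))) *ᵥ φ)).re) / ((L : ℝ) ^ 2 * (R : ℝ) ^ 4) ≤ 16512 / R + 65536 * Real.sqrt τ + 128 / Real.sqrt τ * Real.sqrt (U + (72 + 32 * Real.pi) / R) :=
  fun _ hτ _ hR _ _ hRL _ hU _ _ h1 hGS => mesoCeiling hτ hR hRL hU h1 hGS

/-- **COARSE TIGHTNESS (η before U), unconditional.** For every `δ ∈ (0,1/2)` and every `η > 0` there
is `U₁ > 0` such that for all `U ∈ (0,U₁)` and every admissible ground-state family the small-momentum
window of the `d`-wave pair structure factor is eventually `≤ η L²`: no macroscopic generalised pair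
condensation at weak coupling (the strategist's S⁺₄; PLAN-coarse-tightness (CT)). [folklore] -/
theorem coarseTightness_holds :
    ∀ δ ∈ Set.Ioo (0:ℝ) (1 / 2), ∀ η : ℝ, 0 < η → ∃ U₁ : ℝ, 0 < U₁ ∧ ∀ U ∈ Set.Ioo (0:ℝ) U₁,
      ∀ (N : ℕ → ℕ) (ψ : ∀ L, Fock (Orb (FermionTorus 2 L))),
        (∀ L, Even L → N L = 2 * ⌊(1 - δ) * (L : ℝ) ^ 2 / 2⌋₊ ∧ star (ψ L) ⬝ᵥ ψ L = 1 ∧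
          IsGroundStateInSector (hubbardTorus 2 L 1 U) (N L) 0 (ψ L)) →
        ∃ ε : ℝ, 0 < ε ∧ ∃ L₀ : ℕ, ∀ (L : ℕ) [NeZero L], Even L → L₀ ≤ L →
          (∑ m : Fin 2 → ZMod L, if m ≠ 0 ∧ momentumNormSq L m ≤ ε ^ 2 then
              pairStructureFactor dWaveFormFactor L (ψ L) m else 0) ≤ η * (L : ℝ) ^ 2 :=
  coarseTightness_of_mesoCeiling (by norm_num) (by norm_num) (by norm_num) (by positivity)
    stub_coarseMesoCeiling

/-- **THE UNCONDITIONAL ATOM CEILING.** For every `δ`, every `U ∈ (0,1]`, every admissible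
ground-state family of `hubbardTorus 2 L 1 U` and every pointwise torus-limit `C` (even sides) of its
translation-averaged `d`-wave pair correlations: the condensate atom satisfies
`liminf_R R⁻⁴ Σ_{x,y∈[0,R)²} C(x-y) ≤ 65664 · U^{1/4}` — with NO tightness hypothesis
(PLAN-coarse-tightness (AC); quantifies the `why_might_fail` of crux `NoNormalLimitState`). [folklore] -/
theorem atomCeiling_holds (δ : ℝ) (U : ℝ) (hU : U ∈ Set.Ioc (0:ℝ) 1) (N : ℕ → ℕ)
    (ψ : ∀ L, Fock (Orb (FermionTorus 2 L)))
    (hadm : ∀ L, Even L → N L = 2 * ⌊(1 - δ) * (L : ℝ) ^ 2 / 2⌋₊ ∧ star (ψ L) ⬝ᵥ ψ L = 1 ∧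
      IsGroundStateInSector (hubbardTorus 2 L 1 U) (N L) 0 (ψ L))
    (Ls : ℕ → ℕ) (C : Site 2 → ℝ) (hLs : StrictMono Ls) (hev : ∀ j, Even (Ls j))
    (hconv : ∀ x : Site 2, Tendsto (fun j : ℕ => (∑ y ∈ halfOpenBox 2 (Ls j),
      torusPullback (pairFieldCorr dWaveFormFactor ψ) (Ls j) (x + y) y) / ((Ls j : ℕ) : ℝ) ^ 2)
      atTop (𝓝 (C x))) :
    liminf (fun R : ℕ => (∑ x ∈ halfOpenBox 2 R, ∑ y ∈ halfOpenBox 2 R, C (x - y)) /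
        ((R : ℕ) : ℝ) ^ 4) atTop ≤ 65664 * Real.sqrt (Real.sqrt U) := by
  have h := atom_le_of_mesoCeiling stub_coarseMesoCeiling δ U hU N ψ hadm Ls C hLs hev hconv
  norm_num at h
  exact h

end Meso

end Summit.HubbardSuperconductivity.HubbardSuperconductivity.Theorems.CoarseTightness

end
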